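import Literature.NumberTheory.GaloisRepresentations.UnitIdeles
import Literature.NumberTheory.Automorphic.RankinSelbergTorusIntegral
import Mathlib.MeasureTheory.Group.Measure
import HarnessLib

/-!
# Shell decomposition of the ideles that are units off a finite set of places

Topic `NumberTheory/Automorphic`; namespace `Literature.NumberTheory.Automorphic`. Definitions with
bodies (`ideleUnitBox`, `shellIdele`) and theorems; part of the plumbing of the Kirillov `L²`-bound
into the Rankin–Selberg torus integral (the `n ≤ 2` case of the named fact
`JacquetShalika1981_partialPairL_pole_of_eq_conj`). For a finite set `S'` of finite places and
uniformizers `ϖ_v`, the ideles that are local units at every place outside `S'` decompose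
according to their valuations at `S'`:

  `B(S'ᶜ) = ⨆_{m ∈ ℤ^{S'}} ϖ^m 𝕌_K`,  `ϖ^m = ∏_{v ∈ S'} ι_v(ϖ_v^{m_v})`  (disjoint),

whence, for every left-invariant measure `ν` on `𝕀_K` and every `h ≥ 0`,

  `∫_{B(S'ᶜ)} h dν = Σ_{m ∈ ℤ^{S'}} ∫_{𝕌_K} h(ϖ^m b) dν(b)`  (`setLIntegral_ideleUnitBox_eq_tsum`).

(The rank-one, all-integers analogue of `TorusUnitBoxDecomposition.setLIntegral_unitBox_eq_tsum`.)
[folklore; Tate (1967), §4.3]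

## References

* J. Tate, *Fourier analysis in number fields and Hecke's zeta-functions*, in Cassels–Fröhlich (1967),
  Ch. XV §4.3 [CasselsFrohlichANT1967].
-/

noncomputable section

open MeasureTheory Measure NumberField IsDedekindDomain Set WithZero
open Literature.NumberTheory.GaloisRepresentations (ideleGroup unitIdeles localUnits)
open scoped ENNReal NNReal Pointwise

namespace Literature.NumberTheory.Automorphic

section Shells

variable {K : Type} [Field K] [NumberField K]

/-- The ideles that are local units at every place of `G`. [folklore] -/
def ideleUnitBox (G : Set (HeightOneSpectrum (𝓞 K))) : Set (ideleGroup K) :=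
  {y | ∀ w ∈ G, Valued.v (((y : ideleGroup K) : AdeleRing (𝓞 K) K).2 w) = 1}

/-- `B(all places) = 𝕌_K`. [folklore] -/
theorem ideleUnitBox_univ : ideleUnitBox (K := K) Set.univ = (unitIdeles K : Set (ideleGroup K)) := by
  ext y
  simp only [ideleUnitBox, Set.mem_univ, forall_const, Set.mem_setOf_eq, SetLike.mem_coe,
    GaloisRepresentations.mem_unitIdeles_iff]

/-- The shell idele `ϖ^m = ∏_{v ∈ S'} ι_v(ϖ_v^{m_v})`. [folklore] -/
def shellIdele (ϖ : ∀ v : HeightOneSpectrum (𝓞 K), (v.adicCompletion K)ˣ) (S' : Finset (HeightOneSpectrum (𝓞 K)))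
    (m : ↥S' → ℤ) : ideleGroup K :=
  ∏ v ∈ S'.attach, localUnits v.1 (ϖ v.1 ^ m v)

variable (ϖ : ∀ v : HeightOneSpectrum (𝓞 K), (v.adicCompletion K)ˣ)

/-- Uniformizer powers: `|ϖ^k| = e^{-k}` (as `ShellProjectorBessel.valued_zpow_uniformizer`). [folklore] -/
private theorem valued_zpow_uniformizer' {v : HeightOneSpectrum (𝓞 K)} {π : (v.adicCompletion K)ˣ}
    (hπ : Valued.v (π : v.adicCompletion K) = exp (-1 : ℤ)) (k : ℤ) :
    Valued.v (((π ^ k : (v.adicCompletion K)ˣ) : v.adicCompletion K)) = exp (-k) := by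
  rw [Units.val_zpow_eq_zpow_val, map_zpow₀, hπ, ← WithZero.exp_zsmul, smul_eq_mul, mul_neg, mul_one]

/-- `ι_v(u)` is `1` at `w ≠ v`. [folklore] -/
theorem localUnits_snd_apply_of_ne (v : HeightOneSpectrum (𝓞 K)) (u : (v.adicCompletion K)ˣ) {w : HeightOneSpectrum (𝓞 K)}
    (hw : w ≠ v) : ((localUnits v u : ideleGroup K) : AdeleRing (𝓞 K) K).2 w = 1 := by
  change (GaloisRepresentations.finiteAdeleSingle v _) w = 1
  exact GaloisRepresentations.finiteAdeleSingle_apply_of_ne _ hw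

/-- The finite components of a product of ideles. [folklore] -/
theorem ideleGroup_val_snd_prod {ι : Type*} (s : Finset ι) (f : ι → ideleGroup K) (w : HeightOneSpectrum (𝓞 K)) :
    (((∏ i ∈ s, f i : ideleGroup K)) : AdeleRing (𝓞 K) K).2 w = ∏ i ∈ s, ((f i : ideleGroup K) : AdeleRing (𝓞 K) K).2 w := by
  classical
  induction s using Finset.induction_on with
  | empty => rfl
  | insert a s ha ih => rw [Finset.prod_insert ha, Finset.prod_insert ha, GaloisRepresentations.ideleGroup_val_snd_mul, ih]

/-- The `w`-component of `ϖ^m` at `w ∉ S'` is `1`. [folklore] -/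
theorem shellIdele_snd_of_not_mem {S' : Finset (HeightOneSpectrum (𝓞 K))} (m : ↥S' → ℤ) {w : HeightOneSpectrum (𝓞 K)} (hw : w ∉ S') :
    ((shellIdele ϖ S' m : ideleGroup K) : AdeleRing (𝓞 K) K).2 w = 1 := by
  rw [shellIdele, ideleGroup_val_snd_prod]
  refine Finset.prod_eq_one fun v _ => localUnits_snd_apply_of_ne v.1 _ ?_
  rintro rfl; exact hw v.2

/-- The `v`-component of `ϖ^m` at `v ∈ S'` is `ϖ_v^{m_v}`. [folklore] -/
theorem shellIdele_snd_of_mem {S' : Finset (HeightOneSpectrum (𝓞 K))} (m : ↥S' → ℤ) (v : ↥S') :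
    ((shellIdele ϖ S' m : ideleGroup K) : AdeleRing (𝓞 K) K).2 v.1 = (((ϖ v.1 ^ m v : (v.1.adicCompletion K)ˣ)) : v.1.adicCompletion K) := by
  rw [shellIdele, ideleGroup_val_snd_prod, Finset.prod_eq_single v]
  · exact GaloisRepresentations.localUnits_snd_apply_self _ _
  · intro w _ hwv
    exact localUnits_snd_apply_of_ne w.1 _ fun h => hwv.symm (Subtype.ext h)
  · intro h; exact absurd (Finset.mem_attach _ v) h

/-- The valuation of the `v`-component of `ϖ^m b`, `b ∈ 𝕌_K`, is `exp(-m_v)`. [folklore] -/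
theorem valued_shellIdele_mul_snd (hϖ : ∀ v, Valued.v ((ϖ v : (v.adicCompletion K)ˣ) : v.adicCompletion K) = exp (-1 : ℤ))
    {S' : Finset (HeightOneSpectrum (𝓞 K))} (m : ↥S' → ℤ) {b : ideleGroup K} (hb : b ∈ unitIdeles K) (v : ↥S') :
    Valued.v ((((shellIdele ϖ S' m * b : ideleGroup K)) : AdeleRing (𝓞 K) K).2 v.1) = exp (-m v) := by
  rw [GaloisRepresentations.ideleGroup_val_snd_mul, map_mul, shellIdele_snd_of_mem, valued_zpow_uniformizer' (hϖ v.1),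
    GaloisRepresentations.mem_unitIdeles_iff.1 hb, mul_one]

/-- `ϖ^m b`, `b ∈ 𝕌_K`, is a unit outside `S'`. [folklore] -/
theorem shellIdele_mul_mem_ideleUnitBox {S' : Finset (HeightOneSpectrum (𝓞 K))} (m : ↥S' → ℤ) {b : ideleGroup K} (hb : b ∈ unitIdeles K) :
    shellIdele ϖ S' m * b ∈ ideleUnitBox (K := K) {w | w ∉ S'} := by
  intro w hw
  rw [GaloisRepresentations.ideleGroup_val_snd_mul, map_mul, shellIdele_snd_of_not_mem ϖ m hw, map_one, one_mul]
  exact GaloisRepresentations.mem_unitIdeles_iff.1 hb w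

/-- **The shell decomposition** `B(S'ᶜ) = ⋃_m ϖ^m 𝕌_K`. [folklore] -/
theorem ideleUnitBox_compl_eq_iUnion (hϖ : ∀ v, Valued.v ((ϖ v : (v.adicCompletion K)ˣ) : v.adicCompletion K) = exp (-1 : ℤ))
    (S' : Finset (HeightOneSpectrum (𝓞 K))) :
    ideleUnitBox (K := K) {w | w ∉ S'} = ⋃ m : ↥S' → ℤ, shellIdele ϖ S' m • (unitIdeles K : Set (ideleGroup K)) := by
  ext y
  simp only [Set.mem_iUnion]
  constructor
  · intro hy
    -- the valuations at `S'`
    have hex : ∀ v : ↥S', ∃ k : ℤ, Valued.v (((y : ideleGroup K) : AdeleRing (𝓞 K) K).2 v.1) = exp (-k) := by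
      intro v
      have hne : Valued.v (((y : ideleGroup K) : AdeleRing (𝓞 K) K).2 v.1) ≠ 0 := by
        intro h0
        have hmul : ((y : ideleGroup K) : AdeleRing (𝓞 K) K).2 v.1 * (((y⁻¹ : ideleGroup K)) : AdeleRing (𝓞 K) K).2 v.1 = 1 := by
          rw [← GaloisRepresentations.ideleGroup_val_snd_mul, mul_inv_cancel]; rfl
        have := congrArg Valued.v hmul
        rw [map_mul, h0, zero_mul, map_one] at this
        exact zero_ne_one this
      refine ⟨-Multiplicative.toAdd (unzero hne), ?_⟩
      rw [neg_neg]
      exact (coe_unzero hne).symm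
    choose k hk using hex
    refine ⟨k, Set.mem_smul_set_iff_inv_smul_mem.2 ?_⟩
    show (shellIdele ϖ S' k)⁻¹ * y ∈ (unitIdeles K : Set (ideleGroup K))
    rw [SetLike.mem_coe, GaloisRepresentations.mem_unitIdeles_iff]
    intro w
    rw [GaloisRepresentations.ideleGroup_val_snd_mul, GaloisRepresentations.ideleGroup_val_inv_snd, map_mul, map_inv₀]
    by_cases hw : w ∈ S'
    · rw [shellIdele_snd_of_mem ϖ k ⟨w, hw⟩, valued_zpow_uniformizer' (hϖ w), hk ⟨w, hw⟩, ← exp_neg, ← exp_add, neg_add_cancel, exp_zero]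
    · rw [shellIdele_snd_of_not_mem ϖ k hw, map_one, inv_one, one_mul]
      exact hy w hw
  · rintro ⟨m, hm⟩
    obtain ⟨b, hb, rfl⟩ := Set.mem_smul_set.1 hm
    exact shellIdele_mul_mem_ideleUnitBox ϖ m hb

/-- The shells are pairwise disjoint. [folklore] -/
theorem pairwise_disjoint_shellIdele_smul (hϖ : ∀ v, Valued.v ((ϖ v : (v.adicCompletion K)ˣ) : v.adicCompletion K) = exp (-1 : ℤ))
    (S' : Finset (HeightOneSpectrum (𝓞 K))) :
    Pairwise (Function.onFun Disjoint fun m : ↥S' → ℤ => shellIdele ϖ S' m • (unitIdeles K : Set (ideleGroup K))) := by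
  intro m m' hne
  refine Set.disjoint_left.2 fun y hy hy' => hne ?_
  obtain ⟨b, hb, rfl⟩ := Set.mem_smul_set.1 hy
  obtain ⟨b', hb', heq⟩ := Set.mem_smul_set.1 hy'
  funext v
  have h1 := valued_shellIdele_mul_snd ϖ hϖ m hb v
  have h2 := valued_shellIdele_mul_snd ϖ hϖ m' hb' v
  have heq' : shellIdele ϖ S' m' * b' = shellIdele ϖ S' m * b := heq
  rw [heq', h1] at h2
  have := exp_injective h2
  omega

variable [MeasurableSpace (ideleGroup K)] [BorelSpace (ideleGroup K)]

attribute [local instance] secondCountableTopology_ideleGroup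

/-- The shells are measurable. [folklore] -/
theorem measurableSet_shellIdele_smul (S' : Finset (HeightOneSpectrum (𝓞 K))) (m : ↥S' → ℤ) :
    MeasurableSet (shellIdele ϖ S' m • (unitIdeles K : Set (ideleGroup K))) :=
  ((GaloisRepresentations.isOpen_unitIdeles K).smul _).measurableSet

/-- `B(S'ᶜ)` is measurable. [folklore] -/
theorem measurableSet_ideleUnitBox_compl (hϖ : ∀ v, Valued.v ((ϖ v : (v.adicCompletion K)ˣ) : v.adicCompletion K) = exp (-1 : ℤ))
    (S' : Finset (HeightOneSpectrum (𝓞 K))) : MeasurableSet (ideleUnitBox (K := K) {w | w ∉ S'}) := by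
  rw [ideleUnitBox_compl_eq_iUnion ϖ hϖ S']
  exact MeasurableSet.iUnion fun m => measurableSet_shellIdele_smul ϖ S' m

variable (ν : Measure (ideleGroup K)) [ν.IsMulLeftInvariant]

omit [BorelSpace (ideleGroup K)] in
/-- `∫_{t B} h dν = ∫_B h(t b) dν(b)` for a left-invariant `ν`. [folklore] -/
theorem setLIntegral_smul_left_eq [MeasurableMul (ideleGroup K)] (t : ideleGroup K) (B : Set (ideleGroup K)) (h : ideleGroup K → ℝ≥0∞) :
    ∫⁻ y in t • B, h y ∂ν = ∫⁻ b in B, h (t * b) ∂ν := by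
  have hmp : MeasurePreserving (MeasurableEquiv.mulLeft t) ν ν := measurePreserving_mul_left ν t
  have hpre : (MeasurableEquiv.mulLeft t) ⁻¹' (t • B) = B := by
    ext a
    simp only [MeasurableEquiv.coe_mulLeft, Set.mem_preimage]
    exact Set.smul_mem_smul_set_iff
  calc ∫⁻ y in t • B, h y ∂ν
      = ∫⁻ a in (MeasurableEquiv.mulLeft t) ⁻¹' (t • B), h (MeasurableEquiv.mulLeft t a) ∂ν :=
        (hmp.setLIntegral_comp_preimage_emb (MeasurableEquiv.mulLeft t).measurableEmbedding _ _).symm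
    _ = ∫⁻ b in B, h (t * b) ∂ν := by rw [hpre]; rfl

/-- **`∫_{B(S'ᶜ)} h dν = Σ_{m ∈ ℤ^{S'}} ∫_{𝕌_K} h(ϖ^m b) dν(b)`** for every `h ≥ 0` and every
left-invariant `ν`. [cite: CasselsFrohlichANT1967, Ch. XV §4.3] -/
theorem setLIntegral_ideleUnitBox_eq_tsum (hϖ : ∀ v, Valued.v ((ϖ v : (v.adicCompletion K)ˣ) : v.adicCompletion K) = exp (-1 : ℤ))
    (S' : Finset (HeightOneSpectrum (𝓞 K))) (h : ideleGroup K → ℝ≥0∞) :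
    ∫⁻ y in ideleUnitBox (K := K) {w | w ∉ S'}, h y ∂ν =
      ∑' m : ↥S' → ℤ, ∫⁻ b in (unitIdeles K : Set (ideleGroup K)), h (shellIdele ϖ S' m * b) ∂ν := by
  rw [ideleUnitBox_compl_eq_iUnion ϖ hϖ S', lintegral_iUnion (measurableSet_shellIdele_smul ϖ S') (pairwise_disjoint_shellIdele_smul ϖ hϖ S')]
  exact tsum_congr fun m => setLIntegral_smul_left_eq ν _ _ h

end Shells

end Literature.NumberTheory.Automorphic
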